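import Summits.QuantumFields.YangMills.Theorems.BalabanUVNodesN15KingModelFreeRGGreenAbstract
import HarnessLib

/-!
# BalabanUVNodes ∕ N15 — THE KING-MODEL RUNG, FREE-FIELD EDITION (PART Τ-c₂): THE MOMENTUM SUM ON THE CUBIC TORUS — shell counting
# `#{q : ‖v(q)‖_∞ = n} ≤ 2d(2n+1)^{d−1}`, `Σ_{q≠0} |p′(q)|⁻² ≤ (M∕2π)²·2d·Σ_{n≤M∕2}(2n+1)^{d−1}n⁻²`, the three evaluations `d = 1, 2, 3`, and the
# VARIANCE BOUNDS `(Δ^{(k)})⁻¹(y,y) ≤ M^{−d}[a_k⁻¹ + m⁻² + C_d c⁻¹M²(√M)^{d−1}]` for King's `Δ^{(k)}` and for the bare `−Δ¹ + m²`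
# (Track A, DAG node N15 = NE2; FAN-OUT v1.1 §N15 s3 «KING-MODEL RUNG»; regen R453 (b))

HONEST FRAMING.  Count-neutral (cell `pub-ymgap`, seat `pub-ymgap-dag-n15-e` g19; `--supports stmt-QuantumFields-27366 --as helper` = K3⁸
`SpineGivenEndpointR13SepCoPHV`).  LATTICE COMBINATORICS + the tree's King symbols at `A = 0`: part Τ-c₁ reduced the Gaussian variance
`G(y,y) = ⟨e_y, Δ⁻¹e_y⟩` to the momentum average `|Ω|⁻¹Σ_q D(q)⁻¹` of the inverse symbol; here the sum is evaluated on the CUBIC torus `(ℤ∕Mℤ)^d` for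
symbols with King's coercivity *"Δ^{(k)}(p′) ≥ C|p′|²"* (p. 674; tree `King1986.DeltaEff_ge_momSq`) and a positive zero mode: writing `p′_ν = 2πv_ν∕M`,
`v_ν ∈ (−M∕2, M∕2]` the centred residue (`ZMod.valMinAbs`), `|p′|² ≥ (2π∕M)²‖v‖_∞²`, the shell `{‖v‖_∞ = n}` has at most `2d(2n+1)^{d−1}` points (the
maximal coordinate is `±n`, the others lie in `[−n, n]`; an injection into a `piFinset`), and `Σ_{n=1}^{M∕2}(2n+1)^{d−1}∕n² ≤ 2·3^{d−1}(√(M∕2))^{d−1}` for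
`d = 1, 2, 3` (`Σ1∕n² ≤ 2` = Mathlib's `sum_Ioo_inv_sq_le`, `Σ1∕n ≤ 2√R`, `Σ1 = R`).  Result (★ `green_le_of_symbol`, `kingEffLap_green_le`, `lapF_green_le`): the variance of the unit-lattice
field at a site is `≤ M^{−d}(D(0)⁻¹ + c⁻¹·d·3^{d−1}π⁻²·M²(√M)^{d−1})` — `O(M)` for `d = 1`, `O(√M)`-crude for `d = 2` (true: `log M`), `O(1)` for `d = 3`
— which is all part Τ-g's large-field estimate needs (its threshold grows like `(L^kε)^{−(4−d)∕4}`).  HONEST SCOPE: cubic torus, `1 ≤ d ≤ 3` for the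
evaluated sums (King's `d = 2, 3` plus `d = 1`); the `d = 2` bound is deliberately crude (`√M` for `log M`).  NOT Bałaban's objects; NOT a node discharge;
nothing continuum-YM ∕ ℝ⁴ ∕ OS ∕ mass-gap ∕ Clay.  0 `sorry`; ONE reducible abbreviation (`linfIdx`, the shell index `‖v(q)‖_∞`); standard axioms.
Locators: [King1986] (4.35) p.674 and the sentence *"It is easy to see that Δ^{(k)}(p′) ≥ C|p′|²"*; (4.4)–(4.5) p.670; Thm 3.1 (3.4) p.655.
-/

noncomputable section

namespace Summit.QuantumFields.YangMills.BalabanUVNodes.N15KingModelRung.FreeField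

open Real Finset Matrix
open Literature.MathematicalPhysics.QuantumFieldTheory.Balaban1983to89.B5Prop11Plancherel (Tor sOf abs_sOf_le sOf_ne_zero)
open Literature.MathematicalPhysics.QuantumFieldTheory.Balaban1983to89.QGQInverse (Coercive)
open Literature.MathematicalPhysics.QuantumFieldTheory.King1986 (aK aK_pos aK_le aK_ge DeltaEff DeltaEff_pos' cDelta cDelta_pos cDelta_antitone
  DeltaEff_ge_momSq momSq momSq_nonneg latticeSymbol latticeSymbol_ge_jordan fdSymbol)
open Literature.MathematicalPhysics.QuantumFieldTheory.King1986.Torus (ft parseval_dot lapF lapF_transl transl_form symb_lapF lapSym)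

variable {d : ℕ}

/-! ## §1 The centred residues `v(q)` and the shell index `‖v(q)‖_∞` on `(ℤ∕Mℤ)^d` -/

section Shells

variable (Ms : ℕ) [NeZero Ms]

/-- **The shell index** `‖v(q)‖_∞ = max_ν |v_ν(q)|`, `v_ν(q) ∈ (−M∕2, M∕2]` the centred residue of `q_ν`. Reducible name. [folklore] -/
abbrev linfIdx (q : Fin d → ZMod Ms) : ℕ := Finset.univ.sup fun ν => ((q ν).valMinAbs).natAbs

omit [NeZero Ms] in
/-- Every coordinate is bounded by the shell index. [folklore] -/
theorem natAbs_le_linfIdx (q : Fin d → ZMod Ms) (ν : Fin d) : ((q ν).valMinAbs).natAbs ≤ linfIdx Ms q :=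
  Finset.le_sup (f := fun ν => ((q ν).valMinAbs).natAbs) (Finset.mem_univ ν)

/-- The shell index is at most `M∕2`. [folklore] -/
theorem linfIdx_le (q : Fin d → ZMod Ms) : linfIdx Ms q ≤ Ms / 2 :=
  Finset.sup_le fun ν _ => ZMod.natAbs_valMinAbs_le (q ν)

omit [NeZero Ms] in
/-- A non-zero momentum has a coordinate attaining the (positive) shell index. [folklore] -/
theorem exists_eq_linfIdx {q : Fin d → ZMod Ms} (hq : q ≠ 0) : ∃ ν, ((q ν).valMinAbs).natAbs = linfIdx Ms q ∧ 1 ≤ linfIdx Ms q := by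
  obtain ⟨μ, hμ⟩ := Function.ne_iff.mp hq
  have hne : (Finset.univ : Finset (Fin d)).Nonempty := ⟨μ, Finset.mem_univ μ⟩
  obtain ⟨ν, _, hν⟩ := Finset.exists_mem_eq_sup Finset.univ hne fun ν => ((q ν).valMinAbs).natAbs
  refine ⟨ν, hν.symm, ?_⟩
  have h1 : 1 ≤ ((q μ).valMinAbs).natAbs := by
    rw [Nat.one_le_iff_ne_zero, Int.natAbs_ne_zero]; exact fun h => hμ ((ZMod.valMinAbs_eq_zero (q μ)).mp h)
  exact h1.trans (natAbs_le_linfIdx Ms q μ)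

omit [NeZero Ms] in
/-- **`|p′(q)|² ≥ (2π∕M)²·v_ν(q)²`** for every coordinate `ν` (one term of the sum). [folklore] -/
theorem momSq_ge_coord (q : Fin d → ZMod Ms) (ν : Fin d) :
    (2 * π / Ms) ^ 2 * ((q ν).valMinAbs : ℝ) ^ 2 ≤ momSq (sOf (fun _ : Fin d => Ms) q) := by
  unfold momSq
  have h : (2 * π / Ms) ^ 2 * ((q ν).valMinAbs : ℝ) ^ 2 = (sOf (fun _ : Fin d => Ms) q ν) ^ 2 := by
    simp only [sOf]; ring
  rw [h]
  exact Finset.single_le_sum (f := fun μ => (sOf (fun _ : Fin d => Ms) q μ) ^ 2) (fun μ _ => sq_nonneg _) (Finset.mem_univ ν)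

omit [NeZero Ms] in
/-- **`|p′(q)|² ≥ (2π∕M)²·‖v(q)‖_∞²`**, and `‖v(q)‖_∞ ≥ 1`, for `q ≠ 0`. [folklore] -/
theorem momSq_ge_linfIdx {q : Fin d → ZMod Ms} (hq : q ≠ 0) :
    (2 * π / Ms) ^ 2 * (linfIdx Ms q : ℝ) ^ 2 ≤ momSq (sOf (fun _ : Fin d => Ms) q) := by
  obtain ⟨ν, hν, _⟩ := exists_eq_linfIdx Ms hq
  have h := momSq_ge_coord Ms q ν
  have e : ((q ν).valMinAbs : ℝ) ^ 2 = (linfIdx Ms q : ℝ) ^ 2 := by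
    rw [← hν, ← Int.cast_natCast, Int.natCast_natAbs, Int.cast_abs, sq_abs]
  rwa [e] at h

/-- **THE SHELL COUNT**: `#{q : ‖v(q)‖_∞ = n} ≤ 2d(2n+1)^{d−1}` for `n ≥ 1` — the maximal coordinate is `±n` (2 choices, `d` positions) and the other
`d − 1` coordinates lie in `[−n, n]`; `q ↦ v(q)` is injective (`ZMod.valMinAbs_inj`). [folklore] -/
theorem card_shell_le {n : ℕ} (hn : 1 ≤ n) :
    ((Finset.univ : Finset (Fin d → ZMod Ms)).filter fun q => linfIdx Ms q = n).card ≤ 2 * d * (2 * n + 1) ^ (d - 1) := by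
  classical
  -- cover by the coordinate attaining the maximum
  have hcover : ((Finset.univ : Finset (Fin d → ZMod Ms)).filter fun q => linfIdx Ms q = n)
      ⊆ Finset.univ.biUnion fun ν : Fin d =>
          (Finset.univ : Finset (Fin d → ZMod Ms)).filter fun q => ((q ν).valMinAbs).natAbs = n ∧ ∀ μ, ((q μ).valMinAbs).natAbs ≤ n := by
    intro q hq
    rw [Finset.mem_filter] at hq
    have hq0 : q ≠ 0 := by
      intro h; subst h
      have : linfIdx Ms (0 : Fin d → ZMod Ms) = 0 := by
        apply le_antisymm _ (Nat.zero_le _)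
        exact Finset.sup_le fun ν _ => by simp
      omega
    obtain ⟨ν, hν, _⟩ := exists_eq_linfIdx Ms hq0
    rw [Finset.mem_biUnion]
    refine ⟨ν, Finset.mem_univ ν, ?_⟩
    rw [Finset.mem_filter]
    exact ⟨Finset.mem_univ q, by rw [hν, hq.2], fun μ => by rw [← hq.2]; exact natAbs_le_linfIdx Ms q μ⟩
  -- each piece injects into a box with one coordinate pinned to ±n
  have hpiece : ∀ ν : Fin d,
      ((Finset.univ : Finset (Fin d → ZMod Ms)).filter fun q => ((q ν).valMinAbs).natAbs = n ∧ ∀ μ, ((q μ).valMinAbs).natAbs ≤ n).card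
        ≤ 2 * (2 * n + 1) ^ (d - 1) := by
    intro ν
    set box : Finset (Fin d → ℤ) := Fintype.piFinset fun μ => if μ = ν then ({(n : ℤ), -(n : ℤ)} : Finset ℤ) else Finset.Icc (-(n : ℤ)) n
      with hbox
    have hcard : box.card = 2 * (2 * n + 1) ^ (d - 1) := by
      have h2 : (({(n : ℤ), -(n : ℤ)} : Finset ℤ)).card = 2 := by rw [Finset.card_pair]; omega
      have hI : (Finset.Icc (-(n : ℤ)) n).card = 2 * n + 1 := by rw [Int.card_Icc]; omega
      rw [hbox, Fintype.card_piFinset, ← Finset.mul_prod_erase Finset.univ _ (Finset.mem_univ ν), if_pos rfl, h2]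
      have hrest : ∏ μ ∈ Finset.univ.erase ν, ((if μ = ν then ({(n : ℤ), -(n : ℤ)} : Finset ℤ) else Finset.Icc (-(n : ℤ)) n)).card
          = ∏ _μ ∈ Finset.univ.erase ν, (2 * n + 1) := by
        refine Finset.prod_congr rfl fun μ hμ => ?_
        rw [Finset.mem_erase] at hμ
        rw [if_neg hμ.1, hI]
      rw [hrest, Finset.prod_const, Finset.card_erase_of_mem (Finset.mem_univ ν), Finset.card_univ, Fintype.card_fin]
    rw [← hcard]
    refine Finset.card_le_card_of_injOn (fun q : Fin d → ZMod Ms => fun μ => (q μ).valMinAbs) ?_ ?_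
    · intro q hq
      rw [Finset.mem_coe, Finset.mem_filter] at hq
      rw [Finset.mem_coe, hbox, Fintype.mem_piFinset]
      intro μ
      dsimp only
      by_cases hμ : μ = ν
      · subst hμ
        rw [if_pos rfl, Finset.mem_insert, Finset.mem_singleton]
        have h := hq.2.1
        rcases Int.natAbs_eq (q μ).valMinAbs with h' | h'
        · left; rw [h', h]
        · right; rw [h', h]
      · rw [if_neg hμ, Finset.mem_Icc]
        have h := hq.2.2 μ
        constructor <;> omega
    · intro q _ q' _ hqq
      funext μ
      have h := congrFun hqq μ; dsimp only at h; exact ZMod.valMinAbs_inj.mp h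
  calc ((Finset.univ : Finset (Fin d → ZMod Ms)).filter fun q => linfIdx Ms q = n).card
      ≤ (Finset.univ.biUnion fun ν : Fin d =>
          (Finset.univ : Finset (Fin d → ZMod Ms)).filter fun q => ((q ν).valMinAbs).natAbs = n ∧ ∀ μ, ((q μ).valMinAbs).natAbs ≤ n).card :=
        Finset.card_le_card hcover
    _ ≤ ∑ ν : Fin d, ((Finset.univ : Finset (Fin d → ZMod Ms)).filter
          fun q => ((q ν).valMinAbs).natAbs = n ∧ ∀ μ, ((q μ).valMinAbs).natAbs ≤ n).card := Finset.card_biUnion_le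
    _ ≤ ∑ _ν : Fin d, 2 * (2 * n + 1) ^ (d - 1) := Finset.sum_le_sum fun ν _ => hpiece ν
    _ = 2 * d * (2 * n + 1) ^ (d - 1) := by rw [Finset.sum_const, Finset.card_univ, Fintype.card_fin, smul_eq_mul]; ring

/-- **THE MOMENTUM SUM BY SHELLS**: for a non-negative weight `F(n)` on the shells,
`Σ_{q ≠ 0} F(‖v(q)‖_∞) ≤ Σ_{n=1}^{M∕2} 2d(2n+1)^{d−1}·F(n)`. [folklore] -/
theorem sum_nonzero_le_shells {F : ℕ → ℝ} (hF : ∀ n, 0 ≤ F n) :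
    ∑ q ∈ (Finset.univ : Finset (Fin d → ZMod Ms)).filter (fun q => q ≠ 0), F (linfIdx Ms q)
      ≤ ∑ n ∈ Finset.Icc 1 (Ms / 2), (2 * d * (2 * n + 1) ^ (d - 1) : ℕ) * F n := by
  classical
  have hmaps : ∀ q ∈ (Finset.univ : Finset (Fin d → ZMod Ms)).filter (fun q => q ≠ 0), linfIdx Ms q ∈ Finset.Icc 1 (Ms / 2) := by
    intro q hq
    rw [Finset.mem_filter] at hq
    rw [Finset.mem_Icc]
    exact ⟨(exists_eq_linfIdx Ms hq.2).choose_spec.2, linfIdx_le Ms q⟩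
  rw [← Finset.sum_fiberwise_of_maps_to hmaps]
  refine Finset.sum_le_sum fun n hn => ?_
  rw [Finset.mem_Icc] at hn
  have hconst : ∑ q ∈ ((Finset.univ : Finset (Fin d → ZMod Ms)).filter (fun q => q ≠ 0)).filter (fun q => linfIdx Ms q = n), F (linfIdx Ms q)
      = (((Finset.univ : Finset (Fin d → ZMod Ms)).filter (fun q => q ≠ 0)).filter (fun q => linfIdx Ms q = n)).card * F n := by
    rw [Finset.sum_congr rfl fun q hq => by rw [(Finset.mem_filter.mp hq).2], Finset.sum_const, nsmul_eq_mul]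
  rw [hconst]
  refine mul_le_mul_of_nonneg_right ?_ (hF n)
  have hsub : ((Finset.univ : Finset (Fin d → ZMod Ms)).filter (fun q => q ≠ 0)).filter (fun q => linfIdx Ms q = n)
      ⊆ (Finset.univ : Finset (Fin d → ZMod Ms)).filter fun q => linfIdx Ms q = n := by
    intro q hq
    simp only [Finset.mem_filter, Finset.mem_univ, true_and] at hq ⊢
    exact hq.2
  exact_mod_cast (Finset.card_le_card hsub).trans (card_shell_le Ms hn.1)

end Shells

/-! ## §2 The three shell sums: `Σ1∕n² ≤ 2` (`d = 1`), `Σ3∕n ≤ 6√R` (`d = 2`), `Σ9 = 9R` (`d = 3`) -/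

/- `Σ_{n=1}^{R} n⁻² ≤ 2` is the tree's `Literature.NumberTheory.LFunctions.ZeroDensity.sum_Icc_inv_sq_le_two`; to keep the import closure in the QFT
corner it is re-derived INLINE below from Mathlib's `sum_Ioo_inv_sq_le` (not re-declared). -/

/-- `Σ_{n=1}^{R} n⁻¹ ≤ 2√R` (`1∕n ≤ 2(√n − √(n−1))`, telescoped by induction). [folklore] -/
theorem sum_inv_le_two_sqrt (R : ℕ) : ∑ n ∈ Finset.Icc 1 R, ((n : ℝ))⁻¹ ≤ 2 * Real.sqrt R := by
  induction R with
  | zero => simp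
  | succ R ih =>
    rw [Finset.sum_Icc_succ_top (by omega : 1 ≤ R + 1), Nat.cast_succ]
    have hR0 : (0 : ℝ) ≤ R := Nat.cast_nonneg R
    have hs := Real.sqrt_nonneg (R : ℝ)
    have hs1 : 0 < Real.sqrt ((R : ℝ) + 1) := Real.sqrt_pos.mpr (by linarith)
    -- 1/(R+1) ≤ 2(√(R+1) − √R)
    have hstep : ((R : ℝ) + 1)⁻¹ ≤ 2 * (Real.sqrt ((R : ℝ) + 1) - Real.sqrt R) := by
      have hsum : Real.sqrt ((R : ℝ) + 1) + Real.sqrt R ≤ 2 * ((R : ℝ) + 1) := by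
        have h1 : Real.sqrt ((R : ℝ) + 1) ≤ (R : ℝ) + 1 := by
          rw [Real.sqrt_le_left (by linarith)]; nlinarith
        have h2 : Real.sqrt (R : ℝ) ≤ (R : ℝ) + 1 := by
          rw [Real.sqrt_le_left (by linarith)]; nlinarith
        linarith
      have hprod : (Real.sqrt ((R : ℝ) + 1) - Real.sqrt R) * (Real.sqrt ((R : ℝ) + 1) + Real.sqrt R) = 1 := by
        have e1 := Real.mul_self_sqrt (show (0 : ℝ) ≤ R + 1 by linarith)
        have e2 := Real.mul_self_sqrt hR0
        nlinarith
      have hpos : 0 < Real.sqrt ((R : ℝ) + 1) + Real.sqrt R := by linarith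
      have hdiff : Real.sqrt ((R : ℝ) + 1) - Real.sqrt R = (Real.sqrt ((R : ℝ) + 1) + Real.sqrt R)⁻¹ :=
        eq_inv_of_mul_eq_one_left hprod
      rw [hdiff]
      have hinv : (2 * ((R : ℝ) + 1))⁻¹ ≤ (Real.sqrt ((R : ℝ) + 1) + Real.sqrt R)⁻¹ := inv_anti₀ hpos hsum
      have e : ((R : ℝ) + 1)⁻¹ = 2 * (2 * ((R : ℝ) + 1))⁻¹ := by
        rw [mul_inv, ← mul_assoc, mul_inv_cancel₀ (two_ne_zero' ℝ), one_mul]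
      rw [e]
      exact mul_le_mul_of_nonneg_left hinv (by norm_num)
    linarith

/-- **The shell sums for `d = 1, 2, 3`**: `Σ_{n=1}^{R}(2n+1)^{d−1}∕n² ≤ 2·3^{d−1}·(√R)^{d−1}`. [folklore] -/
theorem sum_shell_weight_le (hd1 : 1 ≤ d) (hd3 : d ≤ 3) (R : ℕ) :
    ∑ n ∈ Finset.Icc 1 R, ((2 * n + 1 : ℕ) : ℝ) ^ (d - 1) / (n : ℝ) ^ 2 ≤ 2 * 3 ^ (d - 1) * Real.sqrt R ^ (d - 1) := by
  interval_cases d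
  · -- d = 1: Σ 1/n² ≤ 2 (Mathlib `sum_Ioo_inv_sq_le` on `Ioo 0 (R+1) = Icc 1 R`)
    simp only [Nat.sub_self, pow_zero, mul_one, one_div]
    have h := sum_Ioo_inv_sq_le (α := ℝ) 0 (R + 1)
    have hI : Finset.Ioo 0 (R + 1) = Finset.Icc 1 R := by
      ext n; simp only [Finset.mem_Ioo, Finset.mem_Icc]; omega
    rw [hI] at h
    simpa using h
  · -- d = 2: Σ (2n+1)/n² ≤ Σ 3/n ≤ 6√R
    simp only [show 2 - 1 = 1 from rfl, pow_one]
    have h := sum_inv_le_two_sqrt R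
    calc ∑ n ∈ Finset.Icc 1 R, ((2 * n + 1 : ℕ) : ℝ) / (n : ℝ) ^ 2 ≤ ∑ n ∈ Finset.Icc 1 R, 3 * ((n : ℝ))⁻¹ := by
          refine Finset.sum_le_sum fun n hn => ?_
          rw [Finset.mem_Icc] at hn
          have hn1 : (1 : ℝ) ≤ n := by exact_mod_cast hn.1
          rw [div_le_iff₀ (by positivity)]
          push_cast
          rw [show 3 * ((n : ℝ))⁻¹ * (n : ℝ) ^ 2 = 3 * n by field_simp]
          linarith
      _ = 3 * ∑ n ∈ Finset.Icc 1 R, ((n : ℝ))⁻¹ := by rw [Finset.mul_sum]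
      _ ≤ 2 * 3 * Real.sqrt R := by linarith
  · -- d = 3: Σ (2n+1)²/n² ≤ 9R ≤ 18 R
    simp only [show 3 - 1 = 2 from rfl]
    have hR : Real.sqrt (R : ℝ) ^ 2 = R := Real.sq_sqrt (Nat.cast_nonneg R)
    rw [hR]
    calc ∑ n ∈ Finset.Icc 1 R, ((2 * n + 1 : ℕ) : ℝ) ^ 2 / (n : ℝ) ^ 2 ≤ ∑ _n ∈ Finset.Icc 1 R, (9 : ℝ) := by
          refine Finset.sum_le_sum fun n hn => ?_
          rw [Finset.mem_Icc] at hn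
          have hn1 : (1 : ℝ) ≤ n := by exact_mod_cast hn.1
          rw [div_le_iff₀ (by positivity)]
          push_cast
          nlinarith
      _ = 9 * R := by rw [Finset.sum_const, Nat.card_Icc, Nat.add_sub_cancel, nsmul_eq_mul]; ring
      _ ≤ 2 * 3 ^ 2 * (R : ℝ) := by have : (0 : ℝ) ≤ R := Nat.cast_nonneg R; nlinarith

/-! ## §3 ★ The variance bound from a coercive symbol on the cubic torus -/

section GreenCube

variable (Ms : ℕ) [NeZero Ms]

/-- `|Ω| = M^d` on the cube. [folklore] -/
theorem card_cubeTor : (Fintype.card (Tor (fun _ : Fin d => Ms)) : ℝ) = (Ms : ℝ) ^ d := by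
  simp [Tor, ZMod.card]

/-- ★ **THE VARIANCE BOUND FROM A COERCIVE SYMBOL**: on the cubic torus `(ℤ∕Mℤ)^d`, `1 ≤ d ≤ 3`, let `Δ` be symmetric and coercive with plane-wave form
`|Ω|⟨x,Δx⟩ = Σ_q D(q)|x̃(q)|²`, `D > 0`, and `D(q) ≥ c·|p′(q)|²` (`c > 0`).  Then for every site `y`:
`⟨e_y, Δ⁻¹e_y⟩ ≤ M^{−d}·(D(0)⁻¹ + c⁻¹(M∕2π)²·2d·2·3^{d−1}·(√M)^{d−1})`. [cite: King1986, (4.35) p.674] -/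
theorem green_le_of_symbol (hd1 : 1 ≤ d) (hd3 : d ≤ 3) {Δ : Matrix (Tor (fun _ : Fin d => Ms)) (Tor (fun _ : Fin d => Ms)) ℝ} {δ : ℝ}
    (hδ : 0 < δ) (hΔ : Coercive Δ δ) {D : Tor (fun _ : Fin d => Ms) → ℝ}
    (hform : ∀ x, (Fintype.card (Tor (fun _ : Fin d => Ms)) : ℝ) * (x ⬝ᵥ (Δ *ᵥ x)) = ∑ q, D q * ‖ft (fun _ : Fin d => Ms) x q‖ ^ 2)
    (hD : ∀ q, 0 < D q) {c : ℝ} (hc : 0 < c) (hcoer : ∀ q, c * momSq (sOf (fun _ : Fin d => Ms) q) ≤ D q) (y : Tor (fun _ : Fin d => Ms)) :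
    Pi.single y (1 : ℝ) ⬝ᵥ (Δ⁻¹ *ᵥ Pi.single y 1)
      ≤ ((Ms : ℝ) ^ d)⁻¹ * ((D 0)⁻¹ + c⁻¹ * ((Ms : ℝ) / (2 * π)) ^ 2 * (2 * d * (2 * 3 ^ (d - 1) * Real.sqrt Ms ^ (d - 1)))) := by
  classical
  have hG := green_single_le (fun _ : Fin d => Ms) hδ hΔ hform hD y
  rw [card_cubeTor] at hG
  refine hG.trans (mul_le_mul_of_nonneg_left ?_ (by positivity))
  -- split off q = 0
  rw [← Finset.sum_filter_add_sum_filter_not Finset.univ (fun q => q = 0), Finset.filter_eq' Finset.univ (0 : Tor (fun _ : Fin d => Ms)),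
    if_pos (Finset.mem_univ _), Finset.sum_singleton]
  refine add_le_add le_rfl ?_
  -- q ≠ 0: D(q)⁻¹ ≤ c⁻¹ (M/2π)² / ‖v‖∞²
  have hMs : (0 : ℝ) < Ms := by exact_mod_cast Nat.pos_of_ne_zero (NeZero.ne Ms)
  have hterm : ∀ q ∈ (Finset.univ : Finset (Tor (fun _ : Fin d => Ms))).filter (fun q => ¬q = 0),
      (D q)⁻¹ ≤ c⁻¹ * ((Ms : ℝ) / (2 * π)) ^ 2 * ((linfIdx Ms q : ℝ) ^ 2)⁻¹ := by
    intro q hq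
    rw [Finset.mem_filter] at hq
    have hq0 : q ≠ 0 := hq.2
    obtain ⟨_, _, h1⟩ := exists_eq_linfIdx Ms hq0
    have hl : (1 : ℝ) ≤ linfIdx Ms q := by exact_mod_cast h1
    have hm := momSq_ge_linfIdx Ms hq0
    have hpos : 0 < c * ((2 * π / Ms) ^ 2 * (linfIdx Ms q : ℝ) ^ 2) := by positivity
    have hle : c * ((2 * π / Ms) ^ 2 * (linfIdx Ms q : ℝ) ^ 2) ≤ D q := (mul_le_mul_of_nonneg_left hm hc.le).trans (hcoer q)
    calc (D q)⁻¹ ≤ (c * ((2 * π / Ms) ^ 2 * (linfIdx Ms q : ℝ) ^ 2))⁻¹ := inv_anti₀ hpos hle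
      _ = c⁻¹ * ((Ms : ℝ) / (2 * π)) ^ 2 * ((linfIdx Ms q : ℝ) ^ 2)⁻¹ := by
          field_simp
  have hne : ((Finset.univ : Finset (Tor (fun _ : Fin d => Ms))).filter fun q => ¬q = 0)
      = (Finset.univ : Finset (Fin d → ZMod Ms)).filter fun q => q ≠ 0 := rfl
  calc ∑ q ∈ (Finset.univ : Finset (Tor (fun _ : Fin d => Ms))).filter (fun q => ¬q = 0), (D q)⁻¹
      ≤ ∑ q ∈ (Finset.univ : Finset (Tor (fun _ : Fin d => Ms))).filter (fun q => ¬q = 0),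
          c⁻¹ * ((Ms : ℝ) / (2 * π)) ^ 2 * ((linfIdx Ms q : ℝ) ^ 2)⁻¹ := Finset.sum_le_sum hterm
    _ = c⁻¹ * ((Ms : ℝ) / (2 * π)) ^ 2 * ∑ q ∈ (Finset.univ : Finset (Fin d → ZMod Ms)).filter (fun q => q ≠ 0),
          ((linfIdx Ms q : ℝ) ^ 2)⁻¹ := by rw [Finset.mul_sum]
    _ ≤ c⁻¹ * ((Ms : ℝ) / (2 * π)) ^ 2 * ∑ n ∈ Finset.Icc 1 (Ms / 2), (2 * d * (2 * n + 1) ^ (d - 1) : ℕ) * (((n : ℝ)) ^ 2)⁻¹ :=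
        mul_le_mul_of_nonneg_left (sum_nonzero_le_shells Ms (F := fun n => (((n : ℝ)) ^ 2)⁻¹) fun n => by positivity) (by positivity)
    _ = c⁻¹ * ((Ms : ℝ) / (2 * π)) ^ 2 * (2 * d * ∑ n ∈ Finset.Icc 1 (Ms / 2), ((2 * n + 1 : ℕ) : ℝ) ^ (d - 1) / (n : ℝ) ^ 2) := by
        congr 1
        rw [Finset.mul_sum]
        refine Finset.sum_congr rfl fun n _ => ?_
        push_cast
        ring
    _ ≤ c⁻¹ * ((Ms : ℝ) / (2 * π)) ^ 2 * (2 * d * (2 * 3 ^ (d - 1) * Real.sqrt Ms ^ (d - 1))) := by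
        refine mul_le_mul_of_nonneg_left (mul_le_mul_of_nonneg_left ?_ (by positivity)) (by positivity)
        refine (sum_shell_weight_le hd1 hd3 (Ms / 2)).trans ?_
        have hsq : Real.sqrt ((Ms / 2 : ℕ) : ℝ) ≤ Real.sqrt (Ms : ℝ) := Real.sqrt_le_sqrt (by exact_mod_cast Nat.div_le_self Ms 2)
        exact mul_le_mul_of_nonneg_left (pow_le_pow_left₀ (Real.sqrt_nonneg _) hsq _) (by positivity)

/-! ## §4 The two operators of the datum: King's `Δ^{(k)}` and the bare `−Δ¹ + m²` -/

/-- **The uniform coercivity constant** `c(a,L) = C_Δ((a(1−L⁻²))⁻¹, d)` of *"Δ^{(k)}(p′) ≥ C|p′|²"*, uniform in `k ≥ 1` (`a_k ≥ a(1−L⁻²)`,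
`cDelta_antitone`). [cite: King1986, p.674] -/
theorem kingEffLap_symbol_coercive {a : ℝ} (ha : 0 < a) {L : ℕ} (hL : 2 ≤ L) {k : ℕ} (hk : 1 ≤ k) {m2 : ℝ} (hm : 0 < m2) (q : Tor (fun _ : Fin d => Ms)) :
    cDelta (a * (1 - ((L : ℝ) ^ 2)⁻¹))⁻¹ d * momSq (sOf (fun _ : Fin d => Ms) q) ≤ DeltaEff (aK a L k) (L ^ k) m2 (sOf (fun _ : Fin d => Ms) q) := by
  have hL1 : (1 : ℝ) < L := by exact_mod_cast hL
  have hak : 0 < aK a L k := aK_pos ha hL1 hk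
  have hamin : 0 < a * (1 - ((L : ℝ) ^ 2)⁻¹) := mul_pos ha (one_sub_invSq_pos hL)
  have hN : 1 ≤ L ^ k := Nat.one_le_pow k L (by omega)
  have h1 := DeltaEff_ge_momSq hak hN hm.le (abs_sOf_le (fun _ : Fin d => Ms) q)
  have hanti : cDelta (a * (1 - ((L : ℝ) ^ 2)⁻¹))⁻¹ d ≤ cDelta (aK a L k)⁻¹ d :=
    cDelta_antitone (inv_pos.mpr hak).le (inv_anti₀ hamin (aK_ge ha hL1 hk)) d
  exact (mul_le_mul_of_nonneg_right hanti (momSq_nonneg _)).trans h1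

/-- ★★ **THE VARIANCE OF THE UNIT-LATTICE FIELD UNDER `e^{−S^{(k),1}}`, `k ≥ 1`**: on the cubic torus `(ℤ∕Mℤ)^d`, `1 ≤ d ≤ 3`, for every site `y`,
`⟨e_y, (Δ^{(k)})⁻¹e_y⟩ ≤ M^{−d}·((a_k⁻¹ + m2⁻¹) + c(a,L)⁻¹(M∕2π)²·4d·3^{d−1}(√M)^{d−1})`, uniformly in `k`. [cite: King1986, (4.35) p.674, (4.5) p.670] -/
theorem kingEffLap_green_le (hd1 : 1 ≤ d) (hd3 : d ≤ 3) {a : ℝ} (ha : 0 < a) {L : ℕ} [NeZero L] (hL : 2 ≤ L) {k : ℕ} (hk : 1 ≤ k)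
    {m2 : ℝ} (hm : 0 < m2) (y : Tor (fun _ : Fin d => Ms)) :
    Pi.single y (1 : ℝ) ⬝ᵥ ((kingEffLap L (fun _ : Fin d => Ms) a m2 k)⁻¹ *ᵥ Pi.single y 1)
      ≤ ((Ms : ℝ) ^ d)⁻¹ * (((aK a L k)⁻¹ + m2⁻¹)
          + (cDelta (a * (1 - ((L : ℝ) ^ 2)⁻¹))⁻¹ d)⁻¹ * ((Ms : ℝ) / (2 * π)) ^ 2 * (2 * d * (2 * 3 ^ (d - 1) * Real.sqrt Ms ^ (d - 1)))) := by
  have hL1 : (1 : ℝ) < L := by exact_mod_cast hL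
  have hL0 : L ≠ 0 := by omega
  haveI : NeZero (L ^ k) := ⟨pow_ne_zero k hL0⟩
  have hak : 0 < aK a L k := aK_pos ha hL1 hk
  have hamin : 0 < a * (1 - ((L : ℝ) ^ 2)⁻¹) := mul_pos ha (one_sub_invSq_pos hL)
  obtain ⟨hδ, _⟩ := deltaFloor_pos_le L ha hL hm
  have hc : 0 < cDelta (a * (1 - ((L : ℝ) ^ 2)⁻¹))⁻¹ d := cDelta_pos (inv_pos.mpr hamin).le d
  have h := green_le_of_symbol Ms hd1 hd3 hδ (kingEffLap_coercive L (fun _ : Fin d => Ms) ha hL hk hm)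
    (D := fun q => DeltaEff (aK a L k) (L ^ k) m2 (sOf (fun _ : Fin d => Ms) q))
    (fun x => kingEffLap_form L (fun _ : Fin d => Ms) ha hL hk hm x) (fun q => DeltaEff_pos' hak (L ^ k) hm.le _) hc
    (fun q => kingEffLap_symbol_coercive Ms ha hL hk hm q) y
  simp only [sOf_zero, DeltaEff_zero, inv_inv] at h
  exact h

omit [NeZero Ms] in
/-- The bare symbol is King's `Δ^η` at `η = 1`: `lapSym 1 m2 q = latticeSymbol 1 m2 (p′(q))`. [cite: King1986, (4.4) p.670] -/
theorem lapSym_eq_latticeSymbol (m2 : ℝ) (q : Tor (fun _ : Fin d => Ms)) :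
    lapSym (fun _ : Fin d => Ms) 1 m2 q = latticeSymbol 1 m2 (sOf (fun _ : Fin d => Ms) q) := by
  unfold lapSym latticeSymbol fdSymbol
  rw [one_mul, add_comm]
  congr 1
  refine Finset.sum_congr rfl fun μ _ => ?_
  rw [one_mul, one_pow, div_one, Real.sin_sq_eq_half_sub, show 2 * (sOf (fun _ : Fin d => Ms) q μ / 2) = sOf (fun _ : Fin d => Ms) q μ by ring]
  ring

/-- ★★ **THE VARIANCE UNDER THE BARE ACTION** (`k = 0`): `⟨e_y, (−Δ¹ + m2)⁻¹e_y⟩ ≤ M^{−d}·(m2⁻¹ + (π²∕4)(M∕2π)²·4d·3^{d−1}(√M)^{d−1})`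
(Jordan: `Δ¹(p′) ≥ (4∕π²)|p′|²`, tree `latticeSymbol_ge_jordan`). [cite: King1986, (4.4) p.670, (4.8) p.671] -/
theorem lapF_green_le (hd1 : 1 ≤ d) (hd3 : d ≤ 3) {m2 : ℝ} (hm : 0 < m2) (y : Tor (fun _ : Fin d => Ms)) :
    Pi.single y (1 : ℝ) ⬝ᵥ ((lapF (fun _ : Fin d => Ms) 1 m2)⁻¹ *ᵥ Pi.single y 1)
      ≤ ((Ms : ℝ) ^ d)⁻¹ * (m2⁻¹ + (4 / π ^ 2)⁻¹ * ((Ms : ℝ) / (2 * π)) ^ 2 * (2 * d * (2 * 3 ^ (d - 1) * Real.sqrt Ms ^ (d - 1)))) := by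
  have hform : ∀ x : Tor (fun _ : Fin d => Ms) → ℝ, (Fintype.card (Tor (fun _ : Fin d => Ms)) : ℝ) * (x ⬝ᵥ (lapF (fun _ : Fin d => Ms) 1 m2 *ᵥ x))
      = ∑ q, lapSym (fun _ : Fin d => Ms) 1 m2 q * ‖ft (fun _ : Fin d => Ms) x q‖ ^ 2 := fun x => by
    rw [transl_form (fun _ : Fin d => Ms) _ (lapF_transl (fun _ : Fin d => Ms) 1 m2) x]
    exact Finset.sum_congr rfl fun q _ => by rw [symb_lapF]
  have hjordan : ∀ q : Tor (fun _ : Fin d => Ms), 4 / π ^ 2 * momSq (sOf (fun _ : Fin d => Ms) q) ≤ lapSym (fun _ : Fin d => Ms) 1 m2 q := by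
    intro q
    rw [lapSym_eq_latticeSymbol]
    have h := latticeSymbol_ge_jordan (η := (1 : ℝ)) one_ne_zero m2 (p := sOf (fun _ : Fin d => Ms) q)
      (fun μ => by rw [one_mul]; exact abs_sOf_le _ q μ)
    linarith
  have hD : ∀ q : Tor (fun _ : Fin d => Ms), 0 < lapSym (fun _ : Fin d => Ms) 1 m2 q := fun q =>
    lt_of_lt_of_le hm (Literature.MathematicalPhysics.QuantumFieldTheory.King1986.Torus.lapSym_ge (fun _ : Fin d => Ms) 1 m2 zero_le_one q)
  have hcoer := Literature.MathematicalPhysics.QuantumFieldTheory.King1986.Torus.lapF_coercive (fun _ : Fin d => Ms) 1 m2 zero_le_one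
  have h := green_le_of_symbol Ms hd1 hd3 hm hcoer (D := fun q => lapSym (fun _ : Fin d => Ms) 1 m2 q) hform hD
    (c := 4 / π ^ 2) (by positivity) hjordan y
  have h0 : lapSym (fun _ : Fin d => Ms) 1 m2 0 = m2 := by
    unfold lapSym; simp
  simp only [h0] at h
  exact h

end GreenCube

end Summit.QuantumFields.YangMills.BalabanUVNodes.N15KingModelRung.FreeField

end
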